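import Literature.AlgebraicGeometry.ModuliOfAbelianVarieties.SiegelUniversalFamilyPieceQuasiProjective
import Literature.AlgebraicGeometry.ModuliOfAbelianVarieties.SiegelTripleDualLevelStructure
import Literature.AlgebraicGeometry.AbelianSchemes.AbelianSchemeConstSubgroupStableCoverOfHom
import Literature.AlgebraicGeometry.AbelianSchemes.PolarizationLamEtale
import Literature.AlgebraicGeometry.AbelianSchemes.PolarizationKernelPairMulN
import Literature.AlgebraicGeometry.AbelianSchemes.PolarizationQuasiInverse
import Literature.AlgebraicGeometry.AbelianSchemes.IsMonHomOfCompFaithfullyFlat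
import HarnessLib

/-!
# `hcov′` for the dual of the universal family over an open piece `S″ ⊆ 𝓜_ℂ` (road E: along a quasi-inverse of `λ`)

Topic `AlgebraicGeometry/ModuliOfAbelianVarieties`; namespace `Literature.AlgebraicGeometry.ModuliOfAbelianVarieties`; a
*proofs* file (theorems only). Cell `hodgecm-mathlib`, socket-(B) chain, brick (B5) (B-plan1 (g15) 00:10:10Z: road E): the
`hcov′` binder of the (ii)-chain quotient files at the DUAL `Â′ = D′.hat` of the `S″`-piece
`P′ := 𝓜.univ.baseChange ι′ℚ` of the universal triple — every point of `Â′` lies in a `K′`-stable open affine over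
`Spec ℂ`, for every finite subgroup `K′ ⊆ Â′(S″)`.

ROAD E. `hcov` holds on `A′` for EVERY finite subgroup (★ `hcov_univ_piece'`, from the quasi-projectivity of the universal
total space). Any `S″`-HOMOMORPHISM `μ : Â′ → A′` which is an AFFINE morphism transfers it to `Â′`
(★ `AbelianSchemeOver.translationActionOver_hcov_of_hom`: `μ⁻¹` of a `μ_*K′`-stable affine open is `K′`-stable and affine):
`hcov'_of_hom`. Such a `μ` is the quasi-inverse of the polarisation `λ′` (★ `Polarization.exists_quasiInverse_of_charZero`:
`λ′ ≫ μ = [e]`, `μ` finite, from `λ′` flat + surjective + quasi-compact (★ `PolarizationLamEtale`, fibres `λ̄′_t` isogenies by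
★ `SiegelFineModuliScheme.isIsogeny_fibreHom_lam_of_classify`) and the kernel-pair identity ★ `comp_mulN_eq_of_comp_lam_eq`
(`λ′` étale in characteristic `0`, `S″` reduced)), a homomorphism by ★ `Polarization.isMonHom_quasiInverse` ((B5-E1)).
No quasi-projectivity of `Â′`, no integrality, no components.

## References

* D. Mumford, *Abelian Varieties* (2nd ed. 1974), §7 Thm. p. 66 and Remark p. 69; §23 «quasi-inverse» p. 231. [MumfordAV1970]
* A. Grothendieck, *SGA 1*, Exp. V, Prop. 1.8. [SGA1]
* D. Mumford, J. Fogarty, F. Kirwan, *GIT*, 3rd ed. (1994), Ch. 6 §2 Prop. 6.13 (iii) (p. 123), Ch. 7 §3 Thm. 7.9 (p. 139).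
  [MumfordFogartyKirwan1994]
-/

noncomputable section

open CategoryTheory CategoryTheory.Limits AlgebraicGeometry MonoidalCategory CartesianMonoidalCategory
open scoped MonObj
open Literature.AlgebraicGeometry.Motives (SchemeOver baseChange baseChangeHomFst)
open Literature.AlgebraicGeometry.HodgeTheory (IsQuasiProjectiveOver)
open Literature.AlgebraicGeometry.AbelianSchemes Literature.AlgebraicGeometry.AbelianSchemes.AbelianSchemeOver
open Literature.AlgebraicGeometry.RelativeSpec

namespace Literature.AlgebraicGeometry.ModuliOfAbelianVarieties

variable {g N : ℕ} {δ : Fin g → ℕ} (𝓜 : SiegelFineModuliScheme g N δ)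
  {S'' : SchemeOver ℂ} (ι' : S'' ⟶ (baseChange ℚ ℂ).obj 𝓜.M) [IsOpenImmersion ι'.left]
  (ι'ℚ : S''.restrictScalars ℚ ⟶ 𝓜.M)

/-- **`hcov′` for `Â′` from any affine homomorphism `μ : Â′ → A′`** (road E): for the `S″`-piece
`P′ = 𝓜.univ.baseChange ι′ℚ` of the universal triple (universal total space quasi-projective over `ℚ`: `hX`) and an
`S″`-homomorphism `μ : Â′ → A′` which is an affine morphism, every point of `Â′` lies in a `K′`-stable open affine over
`Spec ℂ`, for every finite `K′ ⊆ Â′(S″)` (★ `translationActionOver_hcov_of_hom` over ★ `hcov_univ_piece'`).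
[cite: MumfordAV1970, §7 Remark p. 69] [cite: SGA1, Exp. V, Prop. 1.8] -/
theorem hcov'_univ_piece_of_hom (hι : ι'.left ≫ baseChangeHomFst (algebraMap ℚ ℂ) 𝓜.M = ι'ℚ.left)
    (hX : IsQuasiProjectiveOver (Over.mk (𝓜.univ.A.X.hom ≫ 𝓜.M.hom) : SchemeOver ℚ))
    (ψ : (PolarizedAbelianSchemeWithLevel.baseChange (S' := S''.left) 𝓜.univ ι'ℚ.left).D.hat.X ⟶
      (PolarizedAbelianSchemeWithLevel.baseChange (S' := S''.left) 𝓜.univ ι'ℚ.left).A.X) [IsMonHom ψ] [IsAffineHom ψ.left]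
    (K' : Subgroup (PolarizedAbelianSchemeWithLevel.baseChange (S' := S''.left) 𝓜.univ ι'ℚ.left).D.hat.Sections) [Finite K'] :
    ∀ x : (PolarizedAbelianSchemeWithLevel.baseChange (S' := S''.left) 𝓜.univ ι'ℚ.left).D.hat.left,
      ∃ O : ((PolarizedAbelianSchemeWithLevel.baseChange (S' := S''.left) 𝓜.univ ι'ℚ.left).D.hat.translationActionOver
        S''.hom K').StableAffineOpens, x ∈ O.1 :=
  translationActionOver_hcov_of_hom _ _ ψ S''.hom K'
    (fun K _ x => @hcov_univ_piece' g N δ 𝓜 S'' ι' _ ι'ℚ hι hX K ‹_› x)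

/-- **`hcov′` for the dual `Â′` of the `S″`-piece of the universal family** (road E, fully assembled): for a fine Siegel moduli
scheme `𝓜` over `ℚ` (universal total space quasi-projective: `hX` = (F-c″); `𝓜.M` locally of finite type), an open `ℂ`-immersion
`ι′ : S″ → 𝓜_ℂ` with `ℚ`-form `ι′ℚ` from a reduced locally Noetherian `S″` (open in the smooth `𝓜_ℂ`), `∏ δᵢ ≠ 0`, and the
piece `P′ = 𝓜.univ.baseChange ι′ℚ` with commutative group law (★ `isCommMonObj_of_smooth S″.hom`): every point of `Â′ = P′.D.hat`
lies in a `K′`-stable open affine over `Spec ℂ`, for every finite `K′ ⊆ Â′(S″)` — the `hcov′` binder of ★ `quotientBy`/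
`dualPairOfQuotientRigidified` at `(Â′, S″.hom, K′)`. Assembly: `λ̄′_t` isogenies (★ `isIsogeny_fibreHom_lam_of_classify`) ⇒ `λ′`
flat, surjective, quasi-compact, étale (★ `PolarizationLamEtale`) ⇒ kernel-pair identity (★ `comp_mulN_eq_of_comp_lam_eq`,
`e = ∏ δᵢ`) ⇒ quasi-inverse `μ`, `λ′ ≫ μ = [e]`, `μ` finite (★ `exists_quasiInverse_of_charZero`), a homomorphism
(★ `isMonHom_quasiInverse`) ⇒ `hcov'_univ_piece_of_hom`. [cite: MumfordAV1970, §7 Remark p. 69] [cite: SGA1, Exp. V, Prop. 1.8]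
[cite: MumfordFogartyKirwan1994, Ch. 6 §2 Proposition 6.13 (iii) (p. 123)] -/
theorem hcov'_univ_piece [LocallyOfFiniteType 𝓜.M.hom] [IsLocallyNoetherian S''.left] [IsReduced S''.left]
    (hι : ι'.left ≫ baseChangeHomFst (algebraMap ℚ ℂ) 𝓜.M = ι'ℚ.left)
    (hX : IsQuasiProjectiveOver (Over.mk (𝓜.univ.A.X.hom ≫ 𝓜.M.hom) : SchemeOver ℚ)) (hδ : ∏ i, δ i ≠ 0)
    [IsCommMonObj (PolarizedAbelianSchemeWithLevel.baseChange (S' := S''.left) 𝓜.univ ι'ℚ.left).A.X]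
    (K' : Subgroup (PolarizedAbelianSchemeWithLevel.baseChange (S' := S''.left) 𝓜.univ ι'ℚ.left).D.hat.Sections) [Finite K'] :
    ∀ x : (PolarizedAbelianSchemeWithLevel.baseChange (S' := S''.left) 𝓜.univ ι'ℚ.left).D.hat.left,
      ∃ O : ((PolarizedAbelianSchemeWithLevel.baseChange (S' := S''.left) 𝓜.univ ι'ℚ.left).D.hat.translationActionOver
        S''.hom K').StableAffineOpens, x ∈ O.1 := by
  haveI := (PolarizedAbelianSchemeWithLevel.baseChange (S' := S''.left) 𝓜.univ ι'ℚ.left).pol.isMonHom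
  -- `λ̄′_t` is an isogeny at every geometric point (`P′` is classified by `𝓜` over the locally noetherian `ℚ`-scheme `S″`)
  haveI : IsLocallyNoetherian (S''.restrictScalars ℚ).left := ‹IsLocallyNoetherian S''.left›
  have hiso : ∀ ⦃Ω : Type⦄ [Field Ω] [IsAlgClosed Ω] (t : Spec (.of Ω) ⟶ S''.left),
      Motives.AbelianVariety.IsIsogeny (fibreHom (PolarizedAbelianSchemeWithLevel.baseChange (S' := S''.left) 𝓜.univ ι'ℚ.left).pol.lam t) :=
    fun Ω _ _ t => SiegelFineModuliScheme.isIsogeny_fibreHom_lam_of_classify 𝓜 (T := S''.restrictScalars ℚ) (PolarizedAbelianSchemeWithLevel.baseChange (S' := S''.left) 𝓜.univ ι'ℚ.left) t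
  haveI : Flat (PolarizedAbelianSchemeWithLevel.baseChange (S' := S''.left) 𝓜.univ ι'ℚ.left).pol.lam.left := (PolarizedAbelianSchemeWithLevel.baseChange (S' := S''.left) 𝓜.univ ι'ℚ.left).pol.flat_lam_left hiso
  haveI : Surjective (PolarizedAbelianSchemeWithLevel.baseChange (S' := S''.left) 𝓜.univ ι'ℚ.left).pol.lam.left := (PolarizedAbelianSchemeWithLevel.baseChange (S' := S''.left) 𝓜.univ ι'ℚ.left).pol.surjective_lam_left hiso
  haveI : QuasiCompact (PolarizedAbelianSchemeWithLevel.baseChange (S' := S''.left) 𝓜.univ ι'ℚ.left).pol.lam.left := (PolarizedAbelianSchemeWithLevel.baseChange (S' := S''.left) 𝓜.univ ι'ℚ.left).pol.quasiCompact_lam_left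
  haveI : Etale (PolarizedAbelianSchemeWithLevel.baseChange (S' := S''.left) 𝓜.univ ι'ℚ.left).pol.lam.left := (PolarizedAbelianSchemeWithLevel.baseChange (S' := S''.left) 𝓜.univ ι'ℚ.left).pol.etale_lam_left_of_charZero S''.hom hiso
  -- the quasi-inverse `ψ : Â′ → A′`, `λ′ ≫ ψ = [∏ δᵢ]`, finite, a homomorphism
  obtain ⟨ψ, hlamq, -, hfin, -⟩ := (PolarizedAbelianSchemeWithLevel.baseChange (S' := S''.left) 𝓜.univ ι'ℚ.left).pol.exists_quasiInverse_of_charZero S''.hom hδ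
    (fun g₁ g₂ h => (PolarizedAbelianSchemeWithLevel.baseChange (S' := S''.left) 𝓜.univ ι'ℚ.left).pol.comp_mulN_eq_of_comp_lam_eq (PolarizedAbelianSchemeWithLevel.baseChange (S' := S''.left) 𝓜.univ ι'ℚ.left).hasType g₁ g₂ h)
  haveI := hfin
  haveI : IsMonHom ψ := (PolarizedAbelianSchemeWithLevel.baseChange (S' := S''.left) 𝓜.univ ι'ℚ.left).pol.isMonHom_quasiInverse hlamq
  exact @hcov'_univ_piece_of_hom g N δ 𝓜 S'' ι' _ ι'ℚ hι hX ψ _ _ K' ‹Finite K'›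

end Literature.AlgebraicGeometry.ModuliOfAbelianVarieties

end
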